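import Summits.Schanuel.Schanuel.Theorems.RootDecomp1KLevelFinite09
import Summits.Schanuel.Schanuel.Theorems.RootDecomp1KXAll03

/-!
# RootDecomp1KLevelFinite — lens 1, generation 51 ADDENDUM-3 «THE 2-ADICALLY ROOTLESS TOP CLASS + RESIDUAL MOVED SiegelShapes → SiegelShapesOff(At m₀)» (RECORD port, ×0) — part 1 (RootDecomp1KLevelFinite10): §10.1–§10.3 the 2-adically rootless top class

(lens-1 g51 ADDENDUM-3 kernel K⁗ = HOME/decomp-schanuel-lens-1/g51/LevelFiniteRootless.lean 5ccaaffb…, 628 l, 42 thm + 9 def, imports tree …RootDecomp1KLevelFinite09 + …RootDecomp1KXAll03 ONLY; P⁗ b2845109… rc 0 / C0⁗ db3584fd… rc 0 / C⁗ c4042d8e… rc 1 = 13 planted; ADDENDUM-3/NODE L2508 / REQUEST L2509, writer re-check L2510, critic VERDICT L2511: NOT CLEARED for credit (×0 under RULE K-R36 (i), threshold lane closed) — the RESIDUAL RE-BOOKING ACCEPTED AS RECORD and a RECORD PORT recommended; RULE K-R40 (viii) (open territory of record) fixed. RECORD port by census-1 gen 21 as `RootDecomp1KLevelFinite10–11`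 (×0, no credit anywhere): 10 = §10.1–§10.3 the 2-ADICALLY ROOTLESS TOP CLASS — `rootless_lower_bound` (a polynomial with no root in ℚ₂ is bounded below on ℚ₂), `thinFibreAt_xPolyP_of_rootless`, the typed class `RootlessTop e` with `thinFibreAt_of_rootlessTop` / `levelFinite_of_rootlessTop`; 11 = §10.4 members (ω ∉ ℚ₂; the superelliptic curves W^k = Y^(2k−1) − 2 in the coordinate x = W/(Y²+Y+1): `superP`, `thinFibreAt_two_ellipticMember`, `quinticP`), §10.5 position (`not_xLinearLt_superP_two`, `not_separable_top_superP_two`), §10.6 THE RESIDUAL OF RECORD MOVED: `SiegelClause P` ([statement def with parameter] = the four disjuncts of `SiegelShapes` per curve, `siegelShapes_iff_clause`), `SiegelShapesOff` (residual hypothesis: Siegel's clause only OFF the tree-decided classes; NOT proved; sources as in `SiegelShapes`), `siegelShapesOff_of_siegelShapes`, `thinFibre_of_siegelShapesOff`, and §10.7 per quality: `DecidedAt m₀ P` (five disjuncts, each discharged BY TREE NAME), `SiegelShapesOffAt m₀`, **`thinFibre_of_siegelShapesOffAt`**, (b) / SB 2 / 31077-pair corollaries. PORT EDITS: none beyond the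 census module docstring (K has no set_option, no private, no undocumented decl, no «[cite» token); statements and proofs verbatim. `--supports stmt-Schanuel-33364`; rung 0 — nothing here proves Schanuel, 33364, 31077, SiegelShapes(Off) or ThinFibre m₀ hypothesis-free.)
-/

/-!
# RootDecomp1KLevelFinite — lens 1, generation 51 ADDENDUM-3 «THE 2-ADICALLY ROOTLESS TOP CLASS, decided
hypothesis-free at EVERY quality `m₀ ≥ e + 1` — in particular the first curves of `x`-degree `≥ 2` decided at
`m₀ = 2` (genus 1 and 2 members) —, and THE RESIDUAL OF RECORD MOVED: Siegel's clause is needed only OFF the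
tree-decided classes `XLinearLt ∪ RootlessTop 1`»

(lens-1 g51 ADDENDUM-3 kernel K⁗ = HOME/decomp-schanuel-lens-1/g51/LevelFiniteRootless.lean, 2026-09-01; imports ONLY
the tree: `…RootDecomp1KLevelFinite09` = the ported K/K″ line, `…RootDecomp1KXAll03` ⊇ `…RootDecomp1KXTop01/02` =
node 4's class `xPolyP k c = Σ_{j ≤ k} x^j c_j(Y)` with its ultrametric domination `top_coeff_small` and height
arithmetic `infinity_arith`, and the tree's thresholds `thinThreshold`; ONE new section `§10 RootlessTop`.
Standing: rung 0; nothing summit-level; RULE K-R40 (vi)/(vii): a class decided hypothesis-free in residual currency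
(`ThinFibreAt m₀` per prime, `m₀ ≥ 2`) that is NOT x-linear, NOT exceptional and NOT decided in the tree, AND the
residual binder `SiegelShapes` replaced by a strictly weaker typed binder with the weakening PROVED.)

WHAT IS PROVED (hypothesis-free; 0 sorry; standard axioms).
* §10.1 `rootless_lower_bound`: for `f ∈ ℤ[Y]` WITHOUT ROOTS IN `ℚ₂` there is `δ > 0` with
  `δ·max(1, ‖z‖₂)^{deg f} ≤ ‖f(z)‖₂` for every `z ∈ ℚ₂` (chart `‖z‖ ≤ 1`: `ℤ₂` is compact and `‖f‖` continuous and
  positive; chart `‖z‖ > 1`: the reversed polynomial at `z⁻¹ ∈ ℤ₂`); at the rational points of `ℂ₂ = PadicAlgCl 2`: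
  `rootless_lower_bound_ratCast`.
* §10.2 `thinFibreAt_xPolyP_of_rootless`: if `deg c_j ≤ deg c_k + e` (`j < k`) and the top `x`-coefficient `c_k` has
  no root in `ℚ₂`, then `ThinFibreAt m₀ (xPolyP k c)` for EVERY `m₀ ≥ e + 1` — no `m₀ ≥ 3`, no separability, no
  Ridout: by `top_coeff_small` against the lower bound a level point `(N, r)` satisfies `δ·2^{N!} ≤ ‖r‖₂^e ≤ den(r)^e`,
  i.e. it sits 2-adically at `(∞, ∞)`, where the tree's `infinity_arith` concludes.  For `e = 0` more:
  `noLevels_of_rootless` — beyond an explicit level the level curves `P(s_N, ·) = 0` have NO rational point AT ALL —,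
  hence `levelFinite_xPolyP_of_rootless : LevelFinite (xPolyP k c)` and the clause at every `m₀`.
* §10.3 the typed classes `RootlessTop e P := ∃ k c, (∀ j < k, deg c_j ≤ deg c_k + e) ∧ (∀ z : ℚ_[2], c_k(z) ≠ 0) ∧
  P = xPolyP k c` (increasing in `e`, `RootlessTop.mono`): `thinFibreAt_of_rootlessTop : RootlessTop e P →
  e + 1 ≤ m₀ → ThinFibreAt m₀ P`; `levelFinite_of_rootlessTop : RootlessTop 0 P → LevelFinite P`;
  `thinFibreAt_of_rootlessTop_zero` (every `m₀`); `noLevels_of_rootlessTop`.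
* §10.4 members: `rootless_cyc3` — `Y² + Y + 1` has no root in `ℚ₂` (`ω ∉ ℚ₂`: ultrametric off `ℤ₂`, residue field
  `𝔽₂` on `ℤ₂` via `PadicInt.toZMod`); the SUPERELLIPTIC MEMBERS `superP k = x^k(Y²+Y+1)^k − (Y^{2k−1} + 2)`, i.e. the
  curves `W^k = Y^{2k−1} + 2` (genus `(k−1)²`) in the coordinate `x = W/(Y²+Y+1)`: `rootlessTop_superP : RootlessTop 0
  (superP k)`, `levelFinite_superP`, `thinFibreAt_superP` (every `k ≥ 1`, EVERY `m₀`), the elliptic member `k = 2`,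
  `x²(Y²+Y+1)² = Y³ + 2` (`W² = Y³ + 2`): `thinFibreAt_two_ellipticMember : ThinFibreAt 2 (superP 2)`; the genus-2 member
  of order `e = 1`, `quinticP = x²(Y²+Y+1) − (Y³+2)` (`W² = (Y³+2)(Y²+Y+1)`): `rootlessTop_quinticP : RootlessTop 1
  quinticP`, `thinFibreAt_quinticP : 2 ≤ m₀ → ThinFibreAt m₀ quinticP`; `bev_superP`, `bev_quinticP`.
* §10.5 position of the elliptic member: NOT x-linear (`not_xLinearLt_superP_two`; `x`-degree 2), top `(Y²+Y+1)²` NOT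
  separable (`not_separable_top_superP_two`: `μ = 2`, so the tree's separable-top theorems `RootDecomp1KXTop.thinFibreAt_xTop`
  / `…XLinearII…` do not apply and `RootDecomp1KXAll.thinThreshold (superP 2) = max(3, 2μ+1, e+1) = 5`), `Y`-degree 4
  (`thinFibreAt_of_natDegree_lt` needs `m₀ ≥ 5`): the tree gives `ThinFibreAt m₀ (superP 2)` for NO `m₀ ∈ {2, 3, 4}`;
  it has rational points (`ratPoints_superP_two`; `W² = Y³ + 2` has infinitely many) and a REAL point on the fibre
  `x = ℓ₂` (`exists_real_fibre_point_superP_two`, `1 < ℓ₂ < 3/2`), so its clause is vacuous neither globally nor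
  archimedeanly; `not_xLinearLt_quinticP`.
* §10.6 THE RESIDUAL MOVED: `SiegelClause P` = the four disjuncts of K's `SiegelShapes` for one `P`
  (`siegelShapes_iff_clause : SiegelShapes ↔ ∀ P, Prime P → 2 ≤ deg_Y P → SiegelClause P`, by `Iff.rfl`);
  `SiegelShapesOff := ∀ P, Prime P → 2 ≤ deg_Y P → ¬ XLinearLt P → ¬ RootlessTop 1 P → SiegelClause P` — Siegel's
  theorem demanded only OFF node 2's class and this node's class; `siegelShapesOff_of_siegelShapes : SiegelShapes →
  SiegelShapesOff` (the weakening, PROVED); `levelFinite_of_siegelClause` (every exceptional shape being proved in the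
  tree); and the K-line's headlines from the WEAKER binder: `thinFibre_of_siegelShapesOff : SiegelShapesOff →
  2 ≤ m₀ → ThinFibre m₀`, `b_of_siegelShapesOff`, `coordLiouvilleSchanuel_pair_of_siegelShapesOff`.
* §10.7 per quality: `DecidedAt m₀ P` (`deg_Y P < m₀` ∨ `XLinearLt P` ∨ (`3 ≤ m₀` ∧ x-linear with separable `B`) ∨
  `thinThreshold P ≤ m₀` ∨ `RootlessTop (m₀ − 1) P` — each decided BY NAME: `thinFibreAt_of_decidedAt`),
  `SiegelShapesOffAt m₀ := ∀ P, Prime P → 2 ≤ deg_Y P → ¬ DecidedAt m₀ P → SiegelClause P`, and the chain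
  `SiegelShapes → SiegelShapesOff → SiegelShapesOffAt m₀ → ThinFibre m₀` (`siegelShapesOffAt_of_off`,
  `thinFibre_of_siegelShapesOffAt`, `b_of_siegelShapesOffAt`), `m₀ ≥ 2`.

HONESTY.  Rung 0.  The mechanism of §10.1–§10.2 is a LOCAL (2-adic) obstruction — elementary, no Diophantine input:
the curves of `RootlessTop e` have no `ℚ₂`-points 2-adically near `x = ∞` except at `(∞, ∞)`.  `SiegelShapesOff` /
`SiegelShapesOffAt m₀` are implied by `SiegelShapes` (PROVED) and demand strictly fewer instances of Siegel's theorem;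
they are NOT proved (cite item wi-102309 stays load-bearing for the uniform residual).  Items 33364 / 33363 / 31077 (∀),
the (b)-cell, `ThinFibre m₀` (any `m₀ ≥ 2`), `_root_.Schanuel`, `SiegelShapes`, `SiegelShapesOff`: OPEN.
-/

noncomputable section

open Polynomial LiouvilleNumber
open scoped Nat
namespace Summit.Schanuel.Schanuel.Theorems.RootDecomp1KLevelFinite

open Summit.Schanuel.Schanuel.Theorems.RootDecomp1KSkelCell (SkelLiouvilleFix)
open Summit.Schanuel.Schanuel.Theorems.RootDecomp1KTwoBaseCell (psNumer sb_of_range_eq')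
open Summit.Schanuel.Schanuel.Theorems.RootDecomp1KRelLiouvilleCell (partialSum_two_lt_liouvilleNumber
  liouvilleNumber_two_lt partialSum_two_zero)
open Summit.Schanuel.Schanuel.Theorems.RootDecomp1KDegreeLadder
open Summit.Schanuel.Schanuel.Theorems.RootDecomp1KXLinear (xLinP bev_xLinP aeval_ratCast XLinearLt
  thinFibreAt_of_xLinearLt)
open Summit.Schanuel.Schanuel.Theorems.RootDecomp1KXLinearII (thinFibreAt_xLinear_of_sep)
open Summit.Schanuel.Schanuel.Theorems.RootDecomp1KXTop (xPolyP bev_xPolyP top_coeff_small infinity_arith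
  norm_ratCast_le_den)
open Summit.Schanuel.Schanuel.Theorems.RootDecomp1KXAll (thinThreshold thinFibreAt_all)
open Summit.Schanuel.Schanuel.Theorems.RootDecomp1KHyper (SB)

section RootlessTop

/-! ## §10  THE 2-ADICALLY ROOTLESS TOP CLASS

### §10.1  A polynomial without roots in `ℚ₂` is bounded below on `ℚ₂`, homogeneously -/

/-- On the compact chart `ℤ₂`: a polynomial `f ∈ ℤ[Y]` with no root in `ℚ₂` satisfies `‖f(z)‖₂ ≥ δ > 0` for all
`z ∈ ℤ₂` (`ℤ₂` is compact, `z ↦ ‖f(z)‖₂` is continuous and positive). -/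
theorem exists_pos_le_norm_aeval_padicInt (f : ℤ[X]) (hf : ∀ z : ℚ_[2], aeval z f ≠ 0) :
    ∃ δ : ℝ, 0 < δ ∧ ∀ z : ℤ_[2], δ ≤ ‖aeval (z : ℚ_[2]) f‖ := by
  have hcont : Continuous fun z : ℤ_[2] => ‖aeval (z : ℚ_[2]) f‖ :=
    continuous_norm.comp ((Polynomial.continuous_aeval f).comp continuous_subtype_val)
  obtain ⟨z₀, -, hz₀⟩ :=
    (isCompact_univ (X := ℤ_[2])).exists_isMinOn Set.univ_nonempty hcont.continuousOn
  refine ⟨‖aeval (z₀ : ℚ_[2]) f‖, norm_pos_iff.mpr (hf _), fun z => ?_⟩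
  exact (isMinOn_iff.mp hz₀) z (Set.mem_univ z)

/-- The reversed polynomial of a polynomial without roots in `ℚ₂` has no roots in `ℚ₂` either
(`f.reverse(z) · (z⁻¹)^{deg f} = f(z⁻¹)` for `z ≠ 0`, and `f.reverse(0) = lc f ≠ 0`). -/
theorem aeval_reverse_ne_zero (f : ℤ[X]) (hf : ∀ z : ℚ_[2], aeval z f ≠ 0) (z : ℚ_[2]) :
    aeval z f.reverse ≠ 0 := by
  have hf0 : f ≠ 0 := by
    rintro rfl
    exact hf 0 (by simp)
  by_cases hz : z = 0
  · subst hz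
    rw [← coeff_zero_eq_aeval_zero', coeff_zero_reverse, ne_eq,
      map_eq_zero_iff _ (algebraMap ℤ ℚ_[2]).injective_int]
    exact leadingCoeff_ne_zero.mpr hf0
  · letI : Invertible z⁻¹ := invertibleOfNonzero (inv_ne_zero hz)
    have key := eval₂_reverse_mul_pow (algebraMap ℤ ℚ_[2]) z⁻¹ f
    rw [invOf_eq_inv, inv_inv] at key
    intro h
    rw [aeval_def] at h
    rw [h, zero_mul] at key
    exact hf z⁻¹ (by rw [aeval_def]; exact key.symm)

/-- **HOMOGENEOUS LOWER BOUND.**  For `f ∈ ℤ[Y]` without roots in `ℚ₂` there is `δ > 0` with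
`δ · max(1, ‖z‖₂)^{deg f} ≤ ‖f(z)‖₂` for every `z ∈ ℚ₂` (chart `‖z‖ ≤ 1`: compactness; chart `‖z‖ > 1`: the reversed
polynomial at `z⁻¹ ∈ ℤ₂`). -/
theorem rootless_lower_bound (f : ℤ[X]) (hf : ∀ z : ℚ_[2], aeval z f ≠ 0) :
    ∃ δ : ℝ, 0 < δ ∧ ∀ z : ℚ_[2], δ * max 1 ‖z‖ ^ f.natDegree ≤ ‖aeval z f‖ := by
  obtain ⟨δ₁, hδ₁, h₁⟩ := exists_pos_le_norm_aeval_padicInt f hf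
  obtain ⟨δ₂, hδ₂, h₂⟩ := exists_pos_le_norm_aeval_padicInt f.reverse (aeval_reverse_ne_zero f hf)
  refine ⟨min δ₁ δ₂, lt_min hδ₁ hδ₂, fun z => ?_⟩
  by_cases hz : ‖z‖ ≤ 1
  · rw [max_eq_left hz, one_pow, mul_one]
    exact (min_le_left _ _).trans (h₁ ⟨z, hz⟩)
  · rw [not_le] at hz
    have hz0 : z ≠ 0 := by
      rintro rfl
      rw [norm_zero] at hz
      exact absurd hz (by norm_num)
    rw [max_eq_right hz.le]
    have hzi : ‖z⁻¹‖ ≤ 1 := by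
      rw [norm_inv]
      exact inv_le_one_of_one_le₀ hz.le
    letI : Invertible z := invertibleOfNonzero hz0
    have key := eval₂_reverse_mul_pow (algebraMap ℤ ℚ_[2]) z f
    rw [invOf_eq_inv] at key
    have e : ‖aeval z f‖ = ‖aeval z⁻¹ f.reverse‖ * ‖z‖ ^ f.natDegree := by
      rw [aeval_def, aeval_def, ← key, norm_mul, norm_pow]
    rw [e]
    have h₂' : δ₂ ≤ ‖aeval z⁻¹ f.reverse‖ := h₂ ⟨z⁻¹, hzi⟩
    calc min δ₁ δ₂ * ‖z‖ ^ f.natDegree ≤ δ₂ * ‖z‖ ^ f.natDegree := by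
          gcongr; exact min_le_right _ _
      _ ≤ ‖aeval z⁻¹ f.reverse‖ * ‖z‖ ^ f.natDegree := by gcongr

/-- The lower bound at the RATIONAL points of `ℂ₂ = PadicAlgCl 2` (where the tree's level arithmetic lives). -/
theorem rootless_lower_bound_ratCast (f : ℤ[X]) (hf : ∀ z : ℚ_[2], aeval z f ≠ 0) :
    ∃ δ : ℝ, 0 < δ ∧ ∀ r : ℚ, δ * max 1 ‖(r : PadicAlgCl 2)‖ ^ f.natDegree ≤ ‖aeval (r : PadicAlgCl 2) f‖ := by
  obtain ⟨δ, hδ, h⟩ := rootless_lower_bound f hf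
  refine ⟨δ, hδ, fun r => ?_⟩
  have h1 : (r : PadicAlgCl 2) = algebraMap ℚ_[2] (PadicAlgCl 2) (r : ℚ_[2]) := (map_ratCast _ r).symm
  have h2 : aeval (r : PadicAlgCl 2) f = algebraMap ℚ_[2] (PadicAlgCl 2) (aeval (r : ℚ_[2]) f) := by
    rw [h1, aeval_algebraMap_apply]
  have h3 : ‖aeval (r : PadicAlgCl 2) f‖ = ‖aeval (r : ℚ_[2]) f‖ := by
    rw [h2]; exact PadicAlgCl.norm_extends 2 _
  have h4 : ‖(r : PadicAlgCl 2)‖ = ‖(r : ℚ_[2])‖ := by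
    rw [h1]; exact PadicAlgCl.norm_extends 2 _
  rw [h3, h4]
  exact h r

/-! ### §10.2  No level points at all beyond an explicit level -/

/-- **NO LEVELS.**  If the top `x`-coefficient `c_k` of `P = Σ_{j ≤ k} x^j c_j(Y)` dominates the `Y`-degrees
(`deg c_j ≤ deg c_k` for `j < k`) and has NO ROOT in `ℚ₂`, then for all large `N` the level curve `P(s_N, ·) = 0`
has NO rational point whatsoever: the tree's ultrametric domination `‖c_k(r)‖₂ ≤ 2^{−N!}·max(1, ‖r‖₂)^{deg c_k}`
(`top_coeff_small` at `e = 0`) against `rootless_lower_bound_ratCast`. -/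
theorem noLevels_of_rootless (k : ℕ) (c : ℕ → ℤ[X])
    (hdeg : ∀ j, j < k → (c j).natDegree ≤ (c k).natDegree) (hroot : ∀ z : ℚ_[2], aeval z (c k) ≠ 0) :
    ∃ N₀ : ℕ, ∀ N, N₀ ≤ N → ∀ r : ℚ, bev (xPolyP k c) (partialSum 2 N) r ≠ 0 := by
  obtain ⟨δ, hδ, hlow⟩ := rootless_lower_bound_ratCast (c k) hroot
  obtain ⟨n, hn⟩ := exists_pow_lt_of_lt_one hδ (by norm_num : (1 / 2 : ℝ) < 1)
  refine ⟨max 3 n, fun N hN r hP => ?_⟩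
  have hN3 : 3 ≤ N := le_trans (le_max_left _ _) hN
  have hsmall := top_coeff_small k c 0 (fun j hj => by simpa using hdeg j hj) hN3 r hP
  have hbig := hlow r
  rw [add_zero] at hsmall
  have hM : 0 < max 1 ‖(r : PadicAlgCl 2)‖ ^ (c k).natDegree :=
    pow_pos (lt_of_lt_of_le one_pos (le_max_left _ _)) _
  have h1 : δ ≤ (1 / 2 : ℝ) ^ N ! := le_of_mul_le_mul_right (hbig.trans hsmall) hM
  have h2 : (1 / 2 : ℝ) ^ N ! ≤ (1 / 2) ^ n :=
    pow_le_pow_of_le_one (by norm_num) (by norm_num)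
      (le_trans (le_trans (le_max_right 3 n) hN) (Nat.self_le_factorial N))
  linarith

/-- **LEVEL FINITENESS of every such curve — hypothesis-free** (indeed its level sets are eventually EMPTY). -/
theorem levelFinite_xPolyP_of_rootless (k : ℕ) (c : ℕ → ℤ[X])
    (hdeg : ∀ j, j < k → (c j).natDegree ≤ (c k).natDegree) (hroot : ∀ z : ℚ_[2], aeval z (c k) ≠ 0) :
    LevelFinite (xPolyP k c) := by
  obtain ⟨N₀, hN₀⟩ := noLevels_of_rootless k c hdeg hroot
  intro C
  refine (Set.finite_lt_nat N₀).subset ?_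
  rintro N ⟨r, -, hP, -⟩
  by_contra h
  exact hN₀ N (not_lt.mp h) r hP

/-- **THE THIN-FIBRE CLAUSE WITH A POINT AT `(∞, ∞)` OF ORDER `e`** (`deg c_j ≤ deg c_k + e`), top `c_k` without
roots in `ℚ₂`: `ThinFibreAt m₀ P` for every `m₀ ≥ e + 1` — NO Diophantine input and NO `m₀ ≥ 3`: a level point is
2-adically at `(∞, ∞)` (`δ·2^{N!} ≤ ‖r‖₂^e ≤ den(r)^e`, the lower bound against `top_coeff_small`), where the tree's
height arithmetic `infinity_arith` concludes. -/
theorem thinFibreAt_xPolyP_of_rootless (k : ℕ) (c : ℕ → ℤ[X]) (e : ℕ)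
    (hdeg : ∀ j, j < k → (c j).natDegree ≤ (c k).natDegree + e) (hroot : ∀ z : ℚ_[2], aeval z (c k) ≠ 0)
    {m₀ : ℕ} (hme : e + 1 ≤ m₀) : ThinFibreAt m₀ (xPolyP k c) := by
  obtain ⟨δ, hδ, hlow⟩ := rootless_lower_bound_ratCast (c k) hroot
  intro C
  obtain ⟨N₂, hN₂⟩ := infinity_arith δ C hδ e
  refine ⟨max 3 N₂, fun N hN r _ hP _ => ?_⟩
  have hN3 : 3 ≤ N := le_trans (le_max_left _ _) hN
  have hNN₂ : N₂ ≤ N := le_trans (le_max_right _ _) hN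
  have hsmall := top_coeff_small k c e hdeg hN3 r hP
  have hbig := hlow r
  set M : ℝ := max 1 ‖(r : PadicAlgCl 2)‖ with hM
  have hM1 : 1 ≤ M := le_max_left _ _
  have hMd : 0 < M ^ (c k).natDegree := pow_pos (lt_of_lt_of_le one_pos hM1) _
  have hd1 : (1 : ℝ) ≤ r.den := by exact_mod_cast Nat.succ_le_of_lt r.den_pos
  have hMden : M ≤ r.den := max_le hd1 (norm_ratCast_le_den r)
  have h1 : δ ≤ (1 / 2 : ℝ) ^ N ! * M ^ e := by
    have : δ * M ^ (c k).natDegree ≤ ((1 / 2 : ℝ) ^ N ! * M ^ e) * M ^ (c k).natDegree :=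
      calc δ * M ^ (c k).natDegree ≤ ‖aeval (r : PadicAlgCl 2) (c k)‖ := hbig
        _ ≤ (1 / 2 : ℝ) ^ N ! * M ^ ((c k).natDegree + e) := hsmall
        _ = ((1 / 2 : ℝ) ^ N ! * M ^ e) * M ^ (c k).natDegree := by rw [pow_add]; ring
    exact le_of_mul_le_mul_right this hMd
  have h2 : δ * 2 ^ N ! ≤ (r.den : ℝ) ^ e := by
    have h2pos : (0 : ℝ) < 2 ^ N ! := by positivity
    have hhalf : (1 / 2 : ℝ) ^ N ! * 2 ^ N ! = 1 := by
      rw [div_pow, one_pow, div_mul_cancel₀ _ (ne_of_gt h2pos)]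
    calc δ * 2 ^ N ! ≤ ((1 / 2 : ℝ) ^ N ! * M ^ e) * 2 ^ N ! := by gcongr
      _ = M ^ e := by rw [mul_comm ((1 / 2 : ℝ) ^ N !), mul_assoc, hhalf, mul_one]
      _ ≤ (r.den : ℝ) ^ e := pow_le_pow_left₀ (zero_le_one.trans hM1) hMden e
  have h3 := hN₂ N hNN₂ r.den (Nat.succ_le_of_lt r.den_pos) h2
  exact h3.trans_le (pow_le_pow_right₀ hd1 (Nat.mul_le_mul_right _ hme))

/-! ### §10.3  The typed class -/

/-- [class] definition (typed curve class with parameters, NOT a fact; census convention): **the 2-adically rootless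
top class of order `e`** — `P = Σ_{j ≤ k} x^j c_j(Y)` (any `x`-degree `k`) with `deg c_j ≤ deg c_k + e` for `j < k`
(the point `(∞, ∞)` of order `≤ e`) and the top `x`-coefficient `c_k` WITHOUT ROOTS IN `ℚ₂`. -/
def RootlessTop (e : ℕ) (P : ℤ[X][X]) : Prop :=
  ∃ (k : ℕ) (c : ℕ → ℤ[X]), (∀ j, j < k → (c j).natDegree ≤ (c k).natDegree + e) ∧
    (∀ z : ℚ_[2], aeval z (c k) ≠ 0) ∧ P = xPolyP k c

/-- the classes increase with the order `e`. -/
theorem RootlessTop.mono {e e' : ℕ} (h : e ≤ e') {P : ℤ[X][X]} (hP : RootlessTop e P) : RootlessTop e' P := by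
  obtain ⟨k, c, hdeg, hroot, rfl⟩ := hP
  exact ⟨k, c, fun j hj => (hdeg j hj).trans (by omega), hroot, rfl⟩

/-- **THE THIN-FIBRE CLAUSE ON THE WHOLE CLASS `RootlessTop e` AT EVERY `m₀ ≥ e + 1` — hypothesis-free**
(so at every `m₀ ≥ 2` on `RootlessTop 1 ⊇ RootlessTop 0`). -/
theorem thinFibreAt_of_rootlessTop {e : ℕ} {P : ℤ[X][X]} (hP : RootlessTop e P) {m₀ : ℕ} (hme : e + 1 ≤ m₀) :
    ThinFibreAt m₀ P := by
  obtain ⟨k, c, hdeg, hroot, rfl⟩ := hP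
  exact thinFibreAt_xPolyP_of_rootless k c e hdeg hroot hme

/-- **LEVEL FINITENESS ON THE WHOLE CLASS `RootlessTop 0` — hypothesis-free.** -/
theorem levelFinite_of_rootlessTop {P : ℤ[X][X]} (hP : RootlessTop 0 P) : LevelFinite P := by
  obtain ⟨k, c, hdeg, hroot, rfl⟩ := hP
  exact levelFinite_xPolyP_of_rootless k c (fun j hj => by simpa using hdeg j hj) hroot

/-- … hence the thin-fibre clause at EVERY quality `m₀` (including `m₀ ≤ 1`) on `RootlessTop 0`. -/
theorem thinFibreAt_of_rootlessTop_zero {P : ℤ[X][X]} (hP : RootlessTop 0 P) (m₀ : ℕ) : ThinFibreAt m₀ P :=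
  thinFibreAt_of_levelFinite (levelFinite_of_rootlessTop hP) m₀

/-- the eventually-empty form on `RootlessTop 0`: NO level points at all beyond an explicit level. -/
theorem noLevels_of_rootlessTop {P : ℤ[X][X]} (hP : RootlessTop 0 P) :
    ∃ N₀ : ℕ, ∀ N, N₀ ≤ N → ∀ r : ℚ, bev P (partialSum 2 N) r ≠ 0 := by
  obtain ⟨k, c, hdeg, hroot, rfl⟩ := hP
  exact noLevels_of_rootless k c (fun j hj => by simpa using hdeg j hj) hroot

end RootlessTop

end Summit.Schanuel.Schanuel.Theorems.RootDecomp1KLevelFinite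

end
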